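import Summits.HodgeConjecture.HodgeConjecture.Theorems.Ring2AbelianAllWeilSimilarFrames
import Summits.HodgeConjecture.HodgeConjecture.Theorems.Ring2WeilCoverageNormTable
import HarnessLib

/-!
# Ring 2 · Weil-type family-coverage census (ring2-b04, gen 41) — the PFAFFIAN FORM of `det H`:
  `(det Ψ)² = det (Gram of E on the frame {xᵢ, φ^*xᵢ})`, and the placement law for special fibres with integral `K`-symmetry

research route conditional on HC_CM; not a corollary; Q11.4-sentence-2 already refuted in dim ≥ 3.
`HC_CM` (`Theses.RankFourFaces.CMAbelianHodge`, by name) does not occur in this file; no case of the Hodge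
conjecture is claimed. Cell `pub-hodge-ring2`, seat `ring2-b04` (gen 41), census file `WEIL-FAMILY-COVERAGE.md`
§b04.5 (the split-special-fibre column: WHICH component a special fibre with extra integral symmetry can lie on).

## What is proved (0 sorry, no `def`, no named fact)

§1 (pure linear algebra, any commutative ring `R`, `τ² = -d`, `d` a unit):

* `det_fromBlocks_weil` — **`det [[B, A], [-A, d·B]] = det (A + τB) · det (A - τB)`** for ALL square `A`, `B`
  (three elementary block operations and the rotation `J = [[0, -1], [1, 0]] = U L U` of determinant `1`,
  `det_fromBlocks_rotation`).

§2 (van Geemen's Gram matrices, `Literature/…/VanGeemen1994/WeilDiscriminantClass`): for rational `a`, `b` and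
`d ≥ 1`, with `Ψ = a + b√-d = weilGramMatrix d a b ∈ M(K_d)` the Gram matrix of the `K`-Hermitian form `H` in a
`K`-frame `{xᵢ}` and `weilStdGramMatrix n d a b = [[b, a], [-a, d b]]` (ab-weil-1's `Ring2AbelianAllWeilSimilarFrames`
§5) the rational Gram matrix of `E` (`= Q_h/ω`) in the `ℚ`-frame `{xᵢ, φ^*xᵢ}` (its shape is `pairFrame_gram` there:
`E(φ^*u, v) = -E(u, φ^*v)`, `E(φ^*u, φ^*v) = d E(u, v)`):

* `algebraMap_det_weilStdGramMatrix` — `det [[b, a], [-a, d b]] = det Ψ · det Ψ'` in `K_d`, `Ψ' = a - b√-d`;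
* `algebraMap_det_weilStdGramMatrix_of_hermitian` — if `Ψ` is Hermitian (`a` symmetric, `b` antisymmetric — automatic
  for a polarization: `E` alternating and the adjunction above) then **`det [[b, a], [-a, d b]] = (det Ψ)²`**;
* `det_weilStdGramMatrix_eq_sq` — hence for a discriminant witness (`det Ψ = q ∈ ℚˣ`, as in
  `HasWeilDiscriminantNondeg`): `det [[b, a], [-a, d b]] = q²` in `ℚ`.

§3 (the census reading — "Pfaffian form of `det H`", pub-hsemireg t-1's CYCLIC-PRYM LEMMA (L14, Pf-form), stated
there as a candidate for FREE `O_K`-lattices; here at matrix level with the sign and the class):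

* `det_eq_neg_one_pow_mul_of_sq` — if the rational Gram determinant is a square `c²` (`c > 0`) and `det Ψ = q` has
  the Weil-type sign `(-1)ⁿ q > 0` (signature `(n, n)`, van Geemen Lemma 5.2 (4); tree
  `Ring2.AbelianAll.weilSign_eq_of_hasWeilDiscriminantNondeg`) then **`q = (-1)ⁿ c`**, so the discriminant CLASS is
  `[(-1)ⁿ c]` (`mk_det_eq_mk_neg_one_pow_mul_of_sq`) and it is the SPLIT class iff `c ∈ Nm(K_dˣ)`
  (`mk_det_eq_splitDiscriminantClass_iff_of_sq`);
* `mk_det_eq_split_of_sq_two_pow_one` / `…_two` — over `ℚ(i)` and `ℚ(√-2)`, if `c = 2ᵏ` the class is SPLIT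
  (`2 = 1² + 1² = 0² + 2·1²` is a norm);
* `mk_det_eq_split_or_two_of_sq_two_pow` — over any `K_d`, if `c = 2ᵏ` the class is the split class `[(-1)ⁿ]` or
  `[(-1)ⁿ·2]` (according to the parity of `k`, `mk_two_pow_eq_one_or_eq_two`).

WHY THE CENSUS WANTS IT (prose, not kernel): when `{xᵢ}` is a `ℤ[√-d]`-basis of a free sublattice `Λ₀` of finite
index in the integral lattice `Λ` and `E` is integral on `Λ`, the rational Gram matrix is INTEGRAL with determinant
`Pf(E|Λ₀)² = ([Λ:Λ₀] · d₁⋯d_{2n})²` (`(d₁, …, d_{2n})` the type of the polarization); so `det H ≡ (-1)ⁿ [Λ:Λ₀] d₁⋯d_{2n}`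
modulo `Nm(Kˣ)` — the component of a special fibre carrying an INTEGRAL `ℤ[√-d]`-action compatible with `E` is read
off its polarization type and one lattice index. For the Prym `P` of the double cover `C̃ → C̃/⟨-1⟩` inside a
`Q₈`-cover (`WEIL-FAMILY-COVERAGE.md` b01.9) the type is `(1, …, 1, 2, …, 2)`, and for `K' ∈ {ℚ(i), ℚ(√-2)} ⊂ ℍ_ℚ`
(`ℤ[i]`, `ℤ[√-2]` principal, acting through `i`, `i + j ∈ ℤ[Q₈]`) the index can be taken `1`: the component is SPLIT
for every genus and every branch datum (b01.9 computed this in 68 cases); for the ten other census fields `⊂ ℍ_ℚ`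
the class is `[(-1)ⁿ]` or `[(-1)ⁿ 2]` (b01.9's empirical law (E), dichotomy half). Nothing here is a statement
about Hodge classes.

## References

* [vanGeemen1994HodgeAV] B. van Geemen, LNM 1594 (1994), Lemma 5.2 (1)–(4), 5.4 and (5.4.1).
* [LangeBirkenhake1992] H. Lange, Ch. Birkenhake, Complex Abelian Varieties (1992), §3.1 (type of a polarization,
  `det E = (d₁⋯d_g)²`), §12.3–12.4 (Prym varieties of ramified double covers).
* [Markman2025SecantWeil] E. Markman, arXiv:2502.03415 (preprint), §1.1, Lemma 3.1.3.
-/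

noncomputable section

set_option linter.dupNamespace false

open Matrix
open Literature.AlgebraicGeometry.Motives (normUnitsSubgroup)
open Literature.AlgebraicGeometry.VanGeemen1994
open Summit.HodgeConjecture.HodgeConjecture.Ring2.Hypotheses
open Summit.HodgeConjecture.HodgeConjecture.Ring2.AbelianAll (weilStdGramMatrix finPairEquiv)

namespace Summit.HodgeConjecture.HodgeConjecture.Ring2.WeilCoverage

/-! ### §1 The block-determinant identity over a commutative ring -/

section CommRing

variable {R : Type*} [CommRing R] {m : Type*} [Fintype m] [DecidableEq m]

/-- The block rotation `J = [[0, -1], [1, 0]]` is a product of three unipotent block matrices,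
`J = [[1, -1], [0, 1]] · [[1, 0], [1, 1]] · [[1, -1], [0, 1]]`.
research route conditional on HC_CM; not a corollary; Q11.4-sentence-2 already refuted in dim ≥ 3. [folklore] -/
theorem fromBlocks_rotation_eq_mul :
    fromBlocks (0 : Matrix m m R) (-1 : Matrix m m R) (1 : Matrix m m R) (0 : Matrix m m R) =
      fromBlocks (1 : Matrix m m R) (-1 : Matrix m m R) (0 : Matrix m m R) (1 : Matrix m m R) *
        fromBlocks (1 : Matrix m m R) (0 : Matrix m m R) (1 : Matrix m m R) (1 : Matrix m m R) *
        fromBlocks (1 : Matrix m m R) (-1 : Matrix m m R) (0 : Matrix m m R) (1 : Matrix m m R) := by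
  rw [fromBlocks_multiply, fromBlocks_multiply]
  simp

/-- `det [[0, -1], [1, 0]] = 1` (block form, square blocks of any size).
research route conditional on HC_CM; not a corollary; Q11.4-sentence-2 already refuted in dim ≥ 3. [folklore] -/
theorem det_fromBlocks_rotation :
    (fromBlocks (0 : Matrix m m R) (-1 : Matrix m m R) (1 : Matrix m m R) (0 : Matrix m m R)).det = 1 := by
  rw [fromBlocks_rotation_eq_mul, det_mul, det_mul, det_fromBlocks_zero₂₁, det_fromBlocks_zero₁₂, det_one]
  simp

/-- **The Pfaffian form, matrix level.** Over a commutative ring with `τ² = -d`, `d` a unit: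
`det [[B, A], [-A, d·B]] = det (A + τ·B) · det (A - τ·B)` for all square matrices `A`, `B` of the same size.
(With `A` symmetric and `B` alternating the left side is the Gram determinant of an alternating form `E` compatible
with an operator `T`, `T² = -d`, `E(Tu, v) = -E(u, Tv)`, in a frame `{x, Tx}`, and `A + τB` is the Gram matrix of
the Hermitian form `H = E(·, T·) + τ E` — van Geemen Lemma 5.2 (2); then the right side is `(det H)²`.) Proof:
`L · M · U · J = [[A + τB, 0], [dB, A - τB]]` with `L = [[1, λ], [0, 1]]`, `U = [[1, 0], [λ, 1]]`, `λ = τ/d`, and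
the rotation `J` of determinant `1`.
research route conditional on HC_CM; not a corollary; Q11.4-sentence-2 already refuted in dim ≥ 3.
[cite: vanGeemen1994HodgeAV, Lemma 5.2 (2)–(3)] -/
theorem det_fromBlocks_weil (A B : Matrix m m R) {τ d : R} (hτ : τ * τ = -d) (hd : IsUnit d) :
    (fromBlocks B A (-A) (d • B)).det = (A + τ • B).det * (A - τ • B).det := by
  obtain ⟨u, rfl⟩ := hd
  set l : R := τ * ↑u⁻¹ with hl
  have hlu : l * (u : R) = τ := by rw [hl, mul_assoc, Units.inv_mul, mul_one]
  have hul : (u : R) * l = τ := by rw [mul_comm, hlu]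
  have hlt : l * τ = -1 := by rw [hl, mul_right_comm, hτ, neg_mul, Units.mul_inv]
  have h1 : fromBlocks (1 : Matrix m m R) (l • 1) 0 1 * fromBlocks B A (-A) ((u : R) • B) =
      fromBlocks (B - l • A) (A + τ • B) (-A) ((u : R) • B) := by
    rw [fromBlocks_multiply]
    refine fromBlocks_inj.mpr ⟨?_, ?_, ?_, ?_⟩
    · simp [sub_eq_add_neg]
    · simp [smul_smul, hul]
    · simp
    · simp
  have h2 : fromBlocks (B - l • A) (A + τ • B) (-A) ((u : R) • B) * fromBlocks (1 : Matrix m m R) 0 (l • 1) 1 =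
      fromBlocks 0 (A + τ • B) (-(A - τ • B)) ((u : R) • B) := by
    rw [fromBlocks_multiply]
    refine fromBlocks_inj.mpr ⟨?_, ?_, ?_, ?_⟩
    · simp only [Matrix.mul_one, Matrix.mul_smul, smul_add, smul_smul, hlt, neg_one_smul]
      abel
    · simp
    · simp only [Matrix.mul_one, Matrix.mul_smul, smul_smul, hlu]
      abel
    · simp
  have h3 : fromBlocks (0 : Matrix m m R) (A + τ • B) (-(A - τ • B)) ((u : R) • B) *
      fromBlocks (0 : Matrix m m R) (-1 : Matrix m m R) (1 : Matrix m m R) (0 : Matrix m m R) =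
        fromBlocks (A + τ • B) 0 ((u : R) • B) (A - τ • B) := by
    rw [fromBlocks_multiply]
    refine fromBlocks_inj.mpr ⟨?_, ?_, ?_, ?_⟩ <;> simp
  have key : (fromBlocks (1 : Matrix m m R) (l • 1) 0 1 * fromBlocks B A (-A) ((u : R) • B) *
      fromBlocks (1 : Matrix m m R) 0 (l • 1) 1 *
      fromBlocks (0 : Matrix m m R) (-1 : Matrix m m R) (1 : Matrix m m R) (0 : Matrix m m R)).det =
      (fromBlocks (A + τ • B) 0 ((u : R) • B) (A - τ • B)).det := by
    rw [h1, h2, h3]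
  rw [det_mul, det_mul, det_mul, det_fromBlocks_zero₂₁, det_fromBlocks_zero₁₂, det_fromBlocks_rotation,
    det_fromBlocks_zero₁₂, det_one] at key
  simpa only [one_mul, mul_one] using key

end CommRing

/-! ### §2 Van Geemen's Gram matrices: `det [[b, a], [-a, d b]] = det Ψ · det Ψ' = (det Ψ)²` -/

section VanGeemen

variable {k : ℕ}

/-- `Ψ = a + √-d·b` as a matrix identity in `M(K_d)`. [cite: vanGeemen1994HodgeAV, Lemma 5.2 (2)] -/
theorem weilGramMatrix_eq_map_add_smul (d : ℕ) (a b : Matrix (Fin k) (Fin k) ℚ) :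
    weilGramMatrix d a b =
      a.map (algebraMap ℚ (weilField d)) + weilSqrt d • b.map (algebraMap ℚ (weilField d)) := by
  ext i j
  simp [weilGramMatrix_apply, mul_comm]

/-- `Ψ' = a - √-d·b = weilGramMatrix d a (-b)` (the Galois conjugate Gram matrix).
[cite: vanGeemen1994HodgeAV, Lemma 5.2 (2)] -/
theorem weilGramMatrix_neg_eq_map_sub_smul (d : ℕ) (a b : Matrix (Fin k) (Fin k) ℚ) :
    weilGramMatrix d a (-b) =
      a.map (algebraMap ℚ (weilField d)) - weilSqrt d • b.map (algebraMap ℚ (weilField d)) := by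
  ext i j
  simp [weilGramMatrix_apply, mul_comm, sub_eq_add_neg]

/-- The rational block Gram matrix `[[b, a], [-a, d b]]` mapped to `M(K_d)`. [cite: vanGeemen1994HodgeAV, Lemma 5.2 (1)] -/
theorem mapMatrix_fromBlocks_weil (d : ℕ) (a b : Matrix (Fin k) (Fin k) ℚ) :
    (algebraMap ℚ (weilField d)).mapMatrix (fromBlocks b a (-a) ((d : ℚ) • b)) =
      fromBlocks (b.map (algebraMap ℚ (weilField d))) (a.map (algebraMap ℚ (weilField d)))
        (-(a.map (algebraMap ℚ (weilField d))))
        (algebraMap ℚ (weilField d) d • b.map (algebraMap ℚ (weilField d))) := by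
  ext i j
  rcases i with i | i <;> rcases j with j | j <;> simp

/-- `d ≥ 1` is a unit of `K_d`. [folklore] -/
theorem isUnit_algebraMap_natCast_weilField {d : ℕ} (hd : 0 < d) :
    IsUnit (algebraMap ℚ (weilField d) d) :=
  (IsUnit.mk0 (d : ℚ) (by exact_mod_cast hd.ne')).map _

/-- **`det [[b, a], [-a, d b]] = det Ψ · det Ψ'`** in `K_d` (`d ≥ 1`), for ALL rational square `a`, `b`.
research route conditional on HC_CM; not a corollary; Q11.4-sentence-2 already refuted in dim ≥ 3.
[cite: vanGeemen1994HodgeAV, Lemma 5.2 (2)–(3)] -/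
theorem algebraMap_det_fromBlocks_weil {d : ℕ} (hd : 0 < d) (a b : Matrix (Fin k) (Fin k) ℚ) :
    algebraMap ℚ (weilField d) (fromBlocks b a (-a) ((d : ℚ) • b)).det =
      (weilGramMatrix d a b).det * (weilGramMatrix d a (-b)).det := by
  rw [RingHom.map_det, mapMatrix_fromBlocks_weil, weilGramMatrix_eq_map_add_smul,
    weilGramMatrix_neg_eq_map_sub_smul]
  exact det_fromBlocks_weil _ _ (weilSqrt_sq d) (isUnit_algebraMap_natCast_weilField hd)

/-- **The standard `4n`-frame form**: `det (weilStdGramMatrix n d a b) = det Ψ · det Ψ'` in `K_d` — the rational Gram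
matrix of `E` in the frame `{xᵢ, φ^*xᵢ}` (`Ring2.AbelianAll.weilStdGramMatrix`, blocks `[[b, a], [-a, d b]]`,
`Ring2.AbelianAll.pairFrame_gram`) has determinant the `K_d/ℚ`-norm of `det Ψ`.
research route conditional on HC_CM; not a corollary; Q11.4-sentence-2 already refuted in dim ≥ 3.
[cite: vanGeemen1994HodgeAV, Lemma 5.2 (1)–(3)] -/
theorem algebraMap_det_weilStdGramMatrix {n d : ℕ} (hd : 0 < d) (a b : Matrix (Fin (2 * n)) (Fin (2 * n)) ℚ) :
    algebraMap ℚ (weilField d) (weilStdGramMatrix n d a b).det =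
      (weilGramMatrix d a b).det * (weilGramMatrix d a (-b)).det := by
  rw [weilStdGramMatrix, det_submatrix_equiv_self]
  exact algebraMap_det_fromBlocks_weil hd a b

/-- For a HERMITIAN `Ψ` (`a` symmetric, `b` antisymmetric) the conjugate Gram matrix is the transpose: `Ψ' = Ψᵀ`.
[cite: vanGeemen1994HodgeAV, Lemma 5.2 (2)] -/
theorem weilGramMatrix_transpose_of_symm {d : ℕ} {a b : Matrix (Fin k) (Fin k) ℚ} (ha : a.IsSymm)
    (hb : bᵀ = -b) : (weilGramMatrix d a b)ᵀ = weilGramMatrix d a (-b) := by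
  ext i j
  have hb' : b j i = -b i j := by
    have h := congrFun (congrFun hb i) j
    simpa using h
  simp [weilGramMatrix_apply, transpose_apply, ha.apply i j, hb']

/-- **`det [[b, a], [-a, d b]] = (det Ψ)²`** for a Hermitian `Ψ = a + b√-d` (`a` symmetric, `b` antisymmetric;
`d ≥ 1`): the Gram determinant of `E` on the `4n`-frame `{xᵢ, φ^*xᵢ}` is the SQUARE of van Geemen's `det Ψ`.
research route conditional on HC_CM; not a corollary; Q11.4-sentence-2 already refuted in dim ≥ 3.
[cite: vanGeemen1994HodgeAV, Lemma 5.2 (2)–(3)] -/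
theorem algebraMap_det_weilStdGramMatrix_of_hermitian {n d : ℕ} (hd : 0 < d)
    {a b : Matrix (Fin (2 * n)) (Fin (2 * n)) ℚ} (ha : a.IsSymm) (hb : bᵀ = -b) :
    algebraMap ℚ (weilField d) (weilStdGramMatrix n d a b).det = (weilGramMatrix d a b).det ^ 2 := by
  rw [algebraMap_det_weilStdGramMatrix hd, ← weilGramMatrix_transpose_of_symm ha hb, det_transpose]
  exact (sq _).symm

/-- **The Pfaffian form of `det H`, witness level**: if `det Ψ = q ∈ ℚ` (as in a `HasWeilDiscriminantNondeg`
witness) with `Ψ` Hermitian, then `det [[b, a], [-a, d b]] = q²` in `ℚ` — `|q|` is the Pfaffian of the rational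
Gram matrix of `E` on `{xᵢ, φ^*xᵢ}`.
research route conditional on HC_CM; not a corollary; Q11.4-sentence-2 already refuted in dim ≥ 3.
[cite: vanGeemen1994HodgeAV, Lemma 5.2 (2)–(3)] -/
theorem det_weilStdGramMatrix_eq_sq {n d : ℕ} (hd : 0 < d) {a b : Matrix (Fin (2 * n)) (Fin (2 * n)) ℚ}
    (ha : a.IsSymm) (hb : bᵀ = -b) {q : ℚ} (hq : (weilGramMatrix d a b).det = algebraMap ℚ (weilField d) q) :
    (weilStdGramMatrix n d a b).det = q ^ 2 := by
  apply (algebraMap ℚ (weilField d)).injective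
  rw [algebraMap_det_weilStdGramMatrix_of_hermitian hd ha hb, hq, map_pow]

end VanGeemen

/-! ### §3 The census reading: square Gram determinant `c²` ⟹ `det H = (-1)ⁿ c`, class `[(-1)ⁿ c]` -/

section Census

variable {n d : ℕ} {a b : Matrix (Fin (2 * n)) (Fin (2 * n)) ℚ} {q c : ℚ}

/-- **`det H = (-1)ⁿ · c`** when the rational Gram determinant of `E` on `{xᵢ, φ^*xᵢ}` is `c²` (`c > 0`; for an
integral frame `c = [Λ:Λ₀]·d₁⋯d_{2n}`, lattice index times polarization type) and `det Ψ = q` has the Weil-type sign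
`(-1)ⁿ q > 0` (signature `(n, n)`). This is pub-hsemireg t-1's CYCLIC-PRYM LEMMA (L14, Pf-form) «`δ ≡ (-1)ⁿ·Pf(E)`»
at matrix level, with the sign.
research route conditional on HC_CM; not a corollary; Q11.4-sentence-2 already refuted in dim ≥ 3.
[cite: vanGeemen1994HodgeAV, Lemma 5.2 (3)–(4) and (5.4.1)] -/
theorem det_eq_neg_one_pow_mul_of_sq (hd : 0 < d) (ha : a.IsSymm) (hb : bᵀ = -b)
    (hq : (weilGramMatrix d a b).det = algebraMap ℚ (weilField d) q)
    (hc : (weilStdGramMatrix n d a b).det = c ^ 2) (hcpos : 0 < c) (hsign : 0 < (-1 : ℚ) ^ n * q) :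
    q = (-1 : ℚ) ^ n * c := by
  have hsq : q ^ 2 = c ^ 2 := by rw [← det_weilStdGramMatrix_eq_sq hd ha hb hq, hc]
  rcases sq_eq_sq_iff_eq_or_eq_neg.mp hsq with h | h
  · rcases neg_one_pow_eq_or ℚ n with h1 | h1
    · rw [h1, one_mul, h]
    · exfalso
      rw [h1, h] at hsign
      linarith
  · rcases neg_one_pow_eq_or ℚ n with h1 | h1
    · exfalso
      rw [h1, h] at hsign
      linarith
    · rw [h1, h]
      ring

/-- **Class level: `[det H] = [(-1)ⁿ c]`** in `ℚˣ/Nm(K_dˣ)` under the hypotheses of `det_eq_neg_one_pow_mul_of_sq`.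
research route conditional on HC_CM; not a corollary; Q11.4-sentence-2 already refuted in dim ≥ 3.
[cite: vanGeemen1994HodgeAV, Lemma 5.2 (3) and (5.4.1)] -/
theorem mk_det_eq_mk_neg_one_pow_mul_of_sq (hd : 0 < d) (ha : a.IsSymm) (hb : bᵀ = -b)
    (hq : (weilGramMatrix d a b).det = algebraMap ℚ (weilField d) q)
    (hc : (weilStdGramMatrix n d a b).det = c ^ 2) (hcpos : 0 < c) (hsign : 0 < (-1 : ℚ) ^ n * q)
    (hq0 : q ≠ 0) :
    (QuotientGroup.mk (Units.mk0 q hq0) : weilNormResidueGroup d) =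
      QuotientGroup.mk ((-1 : ℚˣ) ^ n * Units.mk0 c hcpos.ne') := by
  congr 1
  ext
  simp [det_eq_neg_one_pow_mul_of_sq hd ha hb hq hc hcpos hsign]

/-- **The split test in Pfaffian form: `[det H]` is the SPLIT class `[(-1)ⁿ]` iff `c ∈ Nm(K_dˣ)`** (`c` the positive
square root of the rational Gram determinant — lattice index times polarization type for an integral frame).
research route conditional on HC_CM; not a corollary; Q11.4-sentence-2 already refuted in dim ≥ 3.
[cite: vanGeemen1994HodgeAV, 5.4 and (5.4.1)] -/
theorem mk_det_eq_splitDiscriminantClass_iff_of_sq (hd : 0 < d) (ha : a.IsSymm) (hb : bᵀ = -b)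
    (hq : (weilGramMatrix d a b).det = algebraMap ℚ (weilField d) q)
    (hc : (weilStdGramMatrix n d a b).det = c ^ 2) (hcpos : 0 < c) (hsign : 0 < (-1 : ℚ) ^ n * q)
    (hq0 : q ≠ 0) :
    (QuotientGroup.mk (Units.mk0 q hq0) : weilNormResidueGroup d) = splitDiscriminantClass n d ↔
      Units.mk0 c hcpos.ne' ∈ normUnitsSubgroup ℚ (weilField d) := by
  rw [mk_det_eq_mk_neg_one_pow_mul_of_sq hd ha hb hq hc hcpos hsign hq0,
    mk_neg_one_pow_mul_eq_splitDiscriminantClass_iff]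

/-- `2ᵏ ∈ Nm(ℚ(i)ˣ)` (`2 = 1² + 1²`). [cite: vanGeemen1994HodgeAV, (5.4.1)] -/
theorem two_pow_mem_normUnitsSubgroup_one (k : ℕ) :
    Units.mk0 ((2 : ℚ) ^ k) (pow_ne_zero k two_ne_zero) ∈ normUnitsSubgroup ℚ (weilField 1) := by
  have h : Units.mk0 ((2 : ℚ) ^ k) (pow_ne_zero k two_ne_zero) = (Units.mk0 (2 : ℚ) two_ne_zero) ^ k := by
    ext
    simp
  rw [h]
  exact Subgroup.pow_mem _ SqrtNeg1.mem_2 k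

/-- `2ᵏ ∈ Nm(ℚ(√-2)ˣ)` (`2 = 0² + 2·1²`). [cite: vanGeemen1994HodgeAV, (5.4.1)] -/
theorem two_pow_mem_normUnitsSubgroup_two (k : ℕ) :
    Units.mk0 ((2 : ℚ) ^ k) (pow_ne_zero k two_ne_zero) ∈ normUnitsSubgroup ℚ (weilField 2) := by
  have h : Units.mk0 ((2 : ℚ) ^ k) (pow_ne_zero k two_ne_zero) = (Units.mk0 (2 : ℚ) two_ne_zero) ^ k := by
    ext
    simp
  rw [h]
  exact Subgroup.pow_mem _ SqrtNeg2.mem_2 k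

/-- **Over `ℚ(i)`: a square Gram determinant `4ᵏ` forces the SPLIT class.** If the rational Gram determinant of `E`
on `{xᵢ, φ^*xᵢ}` is `(2ᵏ)²` (integral `ℤ[i]`-frame, polarization type a power of `2` — e.g. the Prym of a ramified
double cover, type `(1,…,1,2,…,2)`) and `det Ψ = q` has the Weil-type sign, then `[q] = [(-1)ⁿ]`: the member lies
on the SPLIT component `(n, ℚ(i), [(-1)ⁿ])`. (Census b01.9: every `Q₈`-Prym is split for `ℚ(i)`.)
research route conditional on HC_CM; not a corollary; Q11.4-sentence-2 already refuted in dim ≥ 3.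
[cite: vanGeemen1994HodgeAV, 5.4 and (5.4.1)] -/
theorem mk_det_eq_split_of_sq_two_pow_one {a b : Matrix (Fin (2 * n)) (Fin (2 * n)) ℚ} (ha : a.IsSymm)
    (hb : bᵀ = -b) (hq : (weilGramMatrix 1 a b).det = algebraMap ℚ (weilField 1) q) {k : ℕ}
    (hc : (weilStdGramMatrix n 1 a b).det = ((2 : ℚ) ^ k) ^ 2) (hsign : 0 < (-1 : ℚ) ^ n * q) (hq0 : q ≠ 0) :
    (QuotientGroup.mk (Units.mk0 q hq0) : weilNormResidueGroup 1) = splitDiscriminantClass n 1 :=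
  (mk_det_eq_splitDiscriminantClass_iff_of_sq one_pos ha hb hq hc (by positivity) hsign hq0).mpr
    (two_pow_mem_normUnitsSubgroup_one k)

/-- **Over `ℚ(√-2)`: a square Gram determinant `4ᵏ` forces the SPLIT class** (as over `ℚ(i)`; `i + j ∈ ℤ[Q₈]` acts
with square `-2`). (Census b01.9: every `Q₈`-Prym is split for `ℚ(√-2)`.)
research route conditional on HC_CM; not a corollary; Q11.4-sentence-2 already refuted in dim ≥ 3.
[cite: vanGeemen1994HodgeAV, 5.4 and (5.4.1)] -/
theorem mk_det_eq_split_of_sq_two_pow_two {a b : Matrix (Fin (2 * n)) (Fin (2 * n)) ℚ} (ha : a.IsSymm)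
    (hb : bᵀ = -b) (hq : (weilGramMatrix 2 a b).det = algebraMap ℚ (weilField 2) q) {k : ℕ}
    (hc : (weilStdGramMatrix n 2 a b).det = ((2 : ℚ) ^ k) ^ 2) (hsign : 0 < (-1 : ℚ) ^ n * q) (hq0 : q ≠ 0) :
    (QuotientGroup.mk (Units.mk0 q hq0) : weilNormResidueGroup 2) = splitDiscriminantClass n 2 :=
  (mk_det_eq_splitDiscriminantClass_iff_of_sq two_pos ha hb hq hc (by positivity) hsign hq0).mpr
    (two_pow_mem_normUnitsSubgroup_two k)

/-- In any `ℚˣ/Nm(K_dˣ)` the class of `2ᵏ` is `1` (for `k` even) or `[2]` (for `k` odd).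
research route conditional on HC_CM; not a corollary; Q11.4-sentence-2 already refuted in dim ≥ 3. [folklore] -/
theorem mk_two_pow_eq_one_or_eq_two (d k : ℕ) :
    (QuotientGroup.mk (Units.mk0 ((2 : ℚ) ^ k) (pow_ne_zero k two_ne_zero)) : weilNormResidueGroup d) = 1 ∨
      (QuotientGroup.mk (Units.mk0 ((2 : ℚ) ^ k) (pow_ne_zero k two_ne_zero)) : weilNormResidueGroup d) =
        QuotientGroup.mk (Units.mk0 (2 : ℚ) two_ne_zero) := by
  rcases Nat.even_or_odd k with ⟨j, rfl⟩ | ⟨j, rfl⟩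
  · left
    have hx : Units.mk0 ((2 : ℚ) ^ (j + j)) (pow_ne_zero (j + j) two_ne_zero) =
        Units.mk0 (((2 : ℚ) ^ j) ^ 2) (pow_ne_zero 2 (pow_ne_zero j two_ne_zero)) := by
      ext
      simp only [Units.val_mk0]
      ring
    rw [hx]
    exact (QuotientGroup.eq_one_iff _).mpr (sq_mem_normUnitsSubgroup (pow_ne_zero j two_ne_zero))
  · right
    have hx : Units.mk0 ((2 : ℚ) ^ (2 * j + 1)) (pow_ne_zero (2 * j + 1) two_ne_zero) =
        Units.mk0 (((2 : ℚ) ^ j) ^ 2) (pow_ne_zero 2 (pow_ne_zero j two_ne_zero)) *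
          Units.mk0 (2 : ℚ) two_ne_zero := by
      ext
      simp only [Units.val_mk0, Units.val_mul]
      ring
    rw [hx, QuotientGroup.mk_mul, (QuotientGroup.eq_one_iff _).mpr
      (sq_mem_normUnitsSubgroup (pow_ne_zero j two_ne_zero)), one_mul]

/-- **Over any `K_d`: a square Gram determinant `4ᵏ` leaves exactly two classes** — the split class `[(-1)ⁿ]` or
`[(-1)ⁿ·2]`. (Census b01.9 law (E), dichotomy half: a `Q₈`-Prym component has `a ∈ {1, 2}` modulo norms.)
research route conditional on HC_CM; not a corollary; Q11.4-sentence-2 already refuted in dim ≥ 3.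
[cite: vanGeemen1994HodgeAV, 5.4 and (5.4.1)] -/
theorem mk_det_eq_split_or_two_of_sq_two_pow (hd : 0 < d) {a b : Matrix (Fin (2 * n)) (Fin (2 * n)) ℚ}
    (ha : a.IsSymm) (hb : bᵀ = -b) (hq : (weilGramMatrix d a b).det = algebraMap ℚ (weilField d) q) {k : ℕ}
    (hc : (weilStdGramMatrix n d a b).det = ((2 : ℚ) ^ k) ^ 2) (hsign : 0 < (-1 : ℚ) ^ n * q) (hq0 : q ≠ 0) :
    (QuotientGroup.mk (Units.mk0 q hq0) : weilNormResidueGroup d) = splitDiscriminantClass n d ∨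
      (QuotientGroup.mk (Units.mk0 q hq0) : weilNormResidueGroup d) =
        QuotientGroup.mk ((-1 : ℚˣ) ^ n * Units.mk0 (2 : ℚ) two_ne_zero) := by
  rw [mk_det_eq_mk_neg_one_pow_mul_of_sq hd ha hb hq hc (by positivity) hsign hq0, QuotientGroup.mk_mul,
    QuotientGroup.mk_mul]
  rcases mk_two_pow_eq_one_or_eq_two d k with h | h
  · left
    rw [h, mul_one]
  · right
    rw [h]

end Census

end Summit.HodgeConjecture.HodgeConjecture.Ring2.WeilCoverage

end
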